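/-
Copyright (c) 2026 the pub-hodgecm-mathlib formalisation cell (harness21).  Prover seat hodgecm-mathlib-LH3-p02 (g4): line LH3 (closer stub `stub_N9`), LETTER L1 clause (I₁),
organ O-L1e cross-place corners — brick (D) «m-FOLD DRESS» (LH3-plan (g4) RE-DEAL 2026-09-02T11:14:44Z; binder of record F0P3a-p02 (g21), spec 11:13:06Z (D)).
-/
import Literature.NumberTheory.Rogawski1990.ArchOrbFamGExtWallFactorWick    -- ★ p850964 (LH1-p03): brings ★ `circleExp_two_mul_mul_one_sub`, `archERhoG_mul_archRG_eq_mul_prod_erase` (ArchCartanWallFactors), ★ `contDiffAt_coe_splitFrozenFactor`, `contDiff_coe_circleExp_comp_of_contDiff` (WallFactorSmooth), ★ `coe_circleExp_mul_one_sub_mul_one_sub_eq_two_cos_sub` (CosCoshWickJets), ★ the `ne_zero` kit of `ArchCartanNormalisers`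
import HarnessLib

/-!
# (D) THE m-FOLD DRESS: `e^{ρ}_S(c)·R′_S(c) = Br(c) · ∏_k 2 sin ν_k(c)` at an enumerated set of corner places, `Br` smooth off the real walls and non-zero at every
# m-wall-semiregular corner point (Shelstad 1979 §4 Lemma 4.3; Rogawski 1990 §8.2; Bouaziz 1994 §3.1)

Topic `NumberTheory/Rogawski1990`; namespace `Literature.NumberTheory.Rogawski1990`.  THEOREMS ONLY (no `def`, no instance, no notation, no axiom, no named fact, no `sorry`).
Cell `pub/hodgecm-mathlib`, crux H413 (`stmt-HodgeConjecture-24833`), F0∕P3c line LH3 (closer stub `stub_N9`, DIRECT ROAD, leaf v5.1), LETTER L1 clause (I₁), organ O-L1e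
`stub_N9hcCrossCornerJetBounds` (`hX` of ★ `smoothBounded_orbFamGExt_of_strata₄`), road (X1)–(X3): brick **(D) «m-FOLD DRESS»** (LH3-plan (g4) 11:14:44Z → LH3-p02 (g4); binder
of record F0P3a-p02 (g21), spec 11:13:06Z (D): the product over the corner places `e : Fin m ↪ W` of the one-wall factorisation ★ `archERhoG_mul_archRG_add_smul_hcNrm_eq`, shaped
as the `hfac` input of ★ (X1) `exists_nhds_bddAbove_norm_iteratedFDeriv_orbFamGExt_of_multiWallProductModel[_cube]` (p851221): `H₂ (q, ψ) := Br (…) * K * H m P f′ (q, ψ)`).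

THE MATHEMATICS (purely algebraic, GLOBAL — no base point, no neighbourhood).  `e^{ρ}_S R′_S = ∏_w (e^{ρ}-factor_w · R′-factor_w)` (the bodies of ★ `archERhoG`, ★ `archRG`).  At a
compact-chart place `w ∉ S` write `ν := (c_{w0} − c_{w2})∕2`, `θ := (c_{w0} + c_{w2})∕2` (so `c_{w0} = θ + ν`, `c_{w2} = θ − ν`): the `w`-factor is
`e^{2iν}(1 − e^{i(φ−θ−ν)})(1 − e^{−2iν})(1 − e^{i(θ−ν−φ)}) = (2 sin ν) · i · (2cos ν − 2cos(θ − φ))` (★ `circleExp_two_mul_mul_one_sub`, ★ `coe_circleExp_mul_one_sub_mul_one_sub_eq_two_cos_sub`;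
§1).  Splitting the product over `W` into the corner places `Finset.univ.map e` and their complement (Mathlib `Finset.prod_mul_prod_compl`, `Finset.prod_map`) gives
**`e^{ρ}_S(c)·R′_S(c) = Br(c) · ∏_k 2 sin ν_k(c)`** for ALL `c`, with the explicit CORNER BRACKET
`Br(c) = (∏_{w ∉ e} e^{ρ}-factor_w(c)·R′-factor_w(c)) · ∏_k i(2cos ν_k(c) − 2cos(θ_k(c) − c_{(e k)1}))` (§2; a lambda at the call site — no `def`).  `Br` is `C^∞` on the
off-real-walls carrier `Q_S = {c | ∀ w ∈ S, c w 0 ≠ 0}` (open: ★ `ArchCartan.isOpen_setOf_forall_mem_apply_ne_zero`; the split factors `|e^x − e^{−x}|·‖…‖·‖…‖` are smooth off `x = 0`, ★ `contDiffAt_coe_splitFrozenFactor`; everything else is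
entire; §3), and NON-ZERO at every m-WALL-SEMIREGULAR corner point `p` (on all the walls `(e k, 0, 2)`, third eigenvalue off at each corner place, `G`-regular at the other
compact-chart places, off the real walls — LH3-p04 (g4)'s (X2) base-point conjuncts): the corner brackets read `i(2 − 2cos(θ_k − φ_k)) ≠ 0` and the other factors are the
non-vanishing frozen factors of ★ `wallFactor_prod_erase_ne_zero_of_hcSemireg`'s pattern (§4).  §5 packages `∃ Br, smooth ∧ non-zero ∧ identity`.
HONEST LABEL: algebra + calculus bookkeeping for the (X1)–(X3) road, no analysis; HC_CM is proved only modulo the 7 printed citations (2 remaining: hLiu418 =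
`stmt-HodgeConjecture-24832`, h413 = `stmt-HodgeConjecture-24833`) until rung 0 closes; this file is count-neutral.

## References
* [Shelstad1979] D. Shelstad, *Characters and inner forms of a quasi-split group over ℝ*, Compositio Math. 39 (1979), §4 p. 22, p. 24, Lemma 4.3 (p. 25).
* [Rogawski1990] J. D. Rogawski, *Automorphic Representations of Unitary Groups in Three Variables*, Ann. of Math. Stud. 123 (1990), §8.2 pp. 118–124.
* [Bouaziz1994IntegralesOrbitales] A. Bouaziz, *Intégrales orbitales sur les groupes de Lie réductifs*, Ann. Sci. ÉNS 27 (1994), §3.1 (I₁) p. 579, §6.2 p. 591.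
-/

set_option autoImplicit false

noncomputable section

open Set Filter Topology Function Complex
open scoped ContDiff Classical Real

namespace Literature.NumberTheory.Rogawski1990

open Literature.NumberTheory.Automorphic Literature.NumberTheory.Automorphic.ArchCartan Literature.Analysis.Calculus

variable {W : Type*} [Fintype W] [DecidableEq W]

/-! ## §1 The `w`-factor of `e^{ρ}·R′` at a compact-chart place, in the half-difference ∕ half-sum variables -/

omit [Fintype W] [DecidableEq W] in
/-- **`e^{i(c₀−c₂)}·(1 − e^{i(c₁−c₀)})(1 − e^{i(c₂−c₀)})(1 − e^{i(c₂−c₁)}) = (2 sin ν)·i·(2cos ν − 2cos(θ − φ))`** with `c₀ = θ + ν`, `c₂ = θ − ν`, `c₁ = φ`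
(★ `circleExp_two_mul_mul_one_sub`: `e^{2iν}(1−e^{−2iν}) = e^{iν}·2i sin ν`; ★ `coe_circleExp_mul_one_sub_mul_one_sub_eq_two_cos_sub`). [cite: Rogawski1990, §8.2 p. 122] [cite: Shelstad1979, Lemma 4.3 (p. 25)] -/
theorem coe_circleExp_mul_rootFactors_eq_two_sin_mul (θ φ ν : ℝ) :
    (Circle.exp (θ + ν - (θ - ν)) : ℂ) *
        ((1 - (Circle.exp (φ - (θ + ν)) : ℂ)) * (1 - (Circle.exp (θ - ν - (θ + ν)) : ℂ)) * (1 - (Circle.exp (θ - ν - φ) : ℂ))) =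
      ((2 * Real.sin ν : ℝ) : ℂ) * (I * (((2 * Real.cos ν : ℝ) : ℂ) - ((2 * Real.cos (θ - φ) : ℝ) : ℂ))) := by
  rw [show θ + ν - (θ - ν) = 2 * ν by ring, show φ - (θ + ν) = φ - θ - ν by ring, show θ - ν - (θ + ν) = -(2 * ν) by ring]
  calc (Circle.exp (2 * ν) : ℂ) * ((1 - (Circle.exp (φ - θ - ν) : ℂ)) * (1 - (Circle.exp (-(2 * ν)) : ℂ)) * (1 - (Circle.exp (θ - ν - φ) : ℂ)))
      = ((Circle.exp (2 * ν) : ℂ) * (1 - (Circle.exp (-(2 * ν)) : ℂ))) * ((1 - (Circle.exp (φ - θ - ν) : ℂ)) * (1 - (Circle.exp (θ - ν - φ) : ℂ))) := by ring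
    _ = (2 * I * Real.sin ν) * ((Circle.exp ν : ℂ) * ((1 - (Circle.exp (φ - θ - ν) : ℂ)) * (1 - (Circle.exp (θ - ν - φ) : ℂ)))) := by
        rw [circleExp_two_mul_mul_one_sub]; ring
    _ = (2 * I * Real.sin ν) * ((2 * Real.cos ν - 2 * Real.cos (θ - φ) : ℝ) : ℂ) := by rw [coe_circleExp_mul_one_sub_mul_one_sub_eq_two_cos_sub]
    _ = ((2 * Real.sin ν : ℝ) : ℂ) * (I * (((2 * Real.cos ν : ℝ) : ℂ) - ((2 * Real.cos (θ - φ) : ℝ) : ℂ))) := by push_cast; ring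

omit [Fintype W] [DecidableEq W] in
/-- The same factor in the RAW slots `c w 0, c w 1, c w 2` (`ν = (c₀ − c₂)∕2`, `θ = (c₀ + c₂)∕2`). [cite: Rogawski1990, §8.2 p. 122] -/
theorem coe_circleExp_mul_rootFactors_eq_two_sin_mul_bracket (c : W → Fin 3 → ℝ) (w : W) :
    (Circle.exp (c w 0 - c w 2) : ℂ) * ((1 - (Circle.exp (c w 1 - c w 0) : ℂ)) * (1 - (Circle.exp (c w 2 - c w 0) : ℂ)) * (1 - (Circle.exp (c w 2 - c w 1) : ℂ))) =
      ((2 * Real.sin ((c w 0 - c w 2) / 2) : ℝ) : ℂ) * (I * (((2 * Real.cos ((c w 0 - c w 2) / 2) : ℝ) : ℂ) - ((2 * Real.cos ((c w 0 + c w 2) / 2 - c w 1) : ℝ) : ℂ))) := by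
  have h := coe_circleExp_mul_rootFactors_eq_two_sin_mul ((c w 0 + c w 2) / 2) (c w 1) ((c w 0 - c w 2) / 2)
  rw [show (c w 0 + c w 2) / 2 + (c w 0 - c w 2) / 2 = c w 0 by ring, show (c w 0 + c w 2) / 2 - (c w 0 - c w 2) / 2 = c w 2 by ring] at h
  exact h

/-! ## §2 THE m-FOLD DRESS: the global identity -/

/-- **THE m-FOLD DRESS, GLOBAL IDENTITY: `e^{ρ}_S(c)·R′_S(c) = Br(c) · ∏_k 2 sin((c_{(e k)0} − c_{(e k)2})∕2)`** for an enumerated set of compact-chart places `e : Fin m ↪ W`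
(`e k ∉ S`) and EVERY `c`, with the explicit corner bracket `Br(c) = (∏_{w ∉ e} e^{ρ}-factor·R′-factor) · ∏_k i(2cos ν_k − 2cos(θ_k − c_{(e k)1}))` (the product over
`W` split by Mathlib `Finset.prod_mul_prod_compl` at `Finset.univ.map e`, `Finset.prod_map`, §1 at each corner place).
[cite: Shelstad1979, §4 p. 22; p. 24; Lemma 4.3 (p. 25)] [cite: Rogawski1990, §8.2 pp. 118–124] -/
theorem archERhoG_mul_archRG_eq_cornerBracket_mul_prod_sin (S : Finset W) {m : ℕ} (e : Fin m ↪ W) (he : ∀ k, e k ∉ S) (c : W → Fin 3 → ℝ) :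
    archERhoG S c * archRG S c =
      ((∏ w ∈ (Finset.univ.map e)ᶜ,
        ((if w ∈ S then (1 : ℂ) else (Circle.exp (c w 0 - c w 2) : ℂ)) *
          (if w ∈ S then
              ((|Real.exp (c w 0) - Real.exp (-c w 0)| *
                ‖Complex.exp (c w 0 + c w 2 * I) - Complex.exp (c w 1 * I)‖ * ‖Complex.exp (-c w 0 + c w 2 * I) - Complex.exp (c w 1 * I)‖ : ℝ) : ℂ)
            else (1 - (Circle.exp (c w 1 - c w 0) : ℂ)) * (1 - (Circle.exp (c w 2 - c w 0) : ℂ)) * (1 - (Circle.exp (c w 2 - c w 1) : ℂ))))) *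
      ∏ k, (I * (((2 * Real.cos ((c (e k) 0 - c (e k) 2) / 2) : ℝ) : ℂ) - ((2 * Real.cos ((c (e k) 0 + c (e k) 2) / 2 - c (e k) 1) : ℝ) : ℂ)))) *
      ∏ k, ((2 * Real.sin ((c (e k) 0 - c (e k) 2) / 2) : ℝ) : ℂ) := by
  have hsplit : archERhoG S c * archRG S c =
      (∏ w ∈ Finset.univ.map e,
        ((if w ∈ S then (1 : ℂ) else (Circle.exp (c w 0 - c w 2) : ℂ)) *
          (if w ∈ S then
              ((|Real.exp (c w 0) - Real.exp (-c w 0)| *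
                ‖Complex.exp (c w 0 + c w 2 * I) - Complex.exp (c w 1 * I)‖ * ‖Complex.exp (-c w 0 + c w 2 * I) - Complex.exp (c w 1 * I)‖ : ℝ) : ℂ)
            else (1 - (Circle.exp (c w 1 - c w 0) : ℂ)) * (1 - (Circle.exp (c w 2 - c w 0) : ℂ)) * (1 - (Circle.exp (c w 2 - c w 1) : ℂ))))) *
      ∏ w ∈ (Finset.univ.map e)ᶜ,
        ((if w ∈ S then (1 : ℂ) else (Circle.exp (c w 0 - c w 2) : ℂ)) *
          (if w ∈ S then
              ((|Real.exp (c w 0) - Real.exp (-c w 0)| *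
                ‖Complex.exp (c w 0 + c w 2 * I) - Complex.exp (c w 1 * I)‖ * ‖Complex.exp (-c w 0 + c w 2 * I) - Complex.exp (c w 1 * I)‖ : ℝ) : ℂ)
            else (1 - (Circle.exp (c w 1 - c w 0) : ℂ)) * (1 - (Circle.exp (c w 2 - c w 0) : ℂ)) * (1 - (Circle.exp (c w 2 - c w 1) : ℂ)))) := by
    unfold archERhoG archRG
    rw [← Finset.prod_mul_distrib, Finset.prod_mul_prod_compl]
  have hcorner : (∏ w ∈ Finset.univ.map e,
        ((if w ∈ S then (1 : ℂ) else (Circle.exp (c w 0 - c w 2) : ℂ)) *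
          (if w ∈ S then
              ((|Real.exp (c w 0) - Real.exp (-c w 0)| *
                ‖Complex.exp (c w 0 + c w 2 * I) - Complex.exp (c w 1 * I)‖ * ‖Complex.exp (-c w 0 + c w 2 * I) - Complex.exp (c w 1 * I)‖ : ℝ) : ℂ)
            else (1 - (Circle.exp (c w 1 - c w 0) : ℂ)) * (1 - (Circle.exp (c w 2 - c w 0) : ℂ)) * (1 - (Circle.exp (c w 2 - c w 1) : ℂ))))) =
      ∏ k, (((2 * Real.sin ((c (e k) 0 - c (e k) 2) / 2) : ℝ) : ℂ) * (I * (((2 * Real.cos ((c (e k) 0 - c (e k) 2) / 2) : ℝ) : ℂ) - ((2 * Real.cos ((c (e k) 0 + c (e k) 2) / 2 - c (e k) 1) : ℝ) : ℂ)))) := by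
    rw [Finset.prod_map]
    refine Finset.prod_congr rfl fun k _ => ?_
    rw [if_neg (he k), if_neg (he k)]
    exact coe_circleExp_mul_rootFactors_eq_two_sin_mul_bracket c (e k)
  rw [hsplit, hcorner, Finset.prod_mul_distrib]
  ring

/-! ## §3 The corner bracket is smooth off the real walls -/

/-- **The corner bracket `Br` is `C^∞` on `{c | ∀ w ∈ S, c w 0 ≠ 0}`** (compact-chart factors and the corner brackets are entire; the split factors are smooth off `x = 0`,
★ `contDiffAt_coe_splitFrozenFactor`). [cite: Shelstad1979, Lemma 4.3 (p. 25)] [cite: Rogawski1990, §8.2 pp. 118–124] -/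
theorem contDiffOn_cornerBracket (S : Finset W) {m : ℕ} (e : Fin m ↪ W) :
    ContDiffOn ℝ ∞ (fun c : W → Fin 3 → ℝ =>
      (∏ w ∈ (Finset.univ.map e)ᶜ,
        ((if w ∈ S then (1 : ℂ) else (Circle.exp (c w 0 - c w 2) : ℂ)) *
          (if w ∈ S then
              ((|Real.exp (c w 0) - Real.exp (-c w 0)| *
                ‖Complex.exp (c w 0 + c w 2 * I) - Complex.exp (c w 1 * I)‖ * ‖Complex.exp (-c w 0 + c w 2 * I) - Complex.exp (c w 1 * I)‖ : ℝ) : ℂ)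
            else (1 - (Circle.exp (c w 1 - c w 0) : ℂ)) * (1 - (Circle.exp (c w 2 - c w 0) : ℂ)) * (1 - (Circle.exp (c w 2 - c w 1) : ℂ))))) *
      ∏ k, (I * (((2 * Real.cos ((c (e k) 0 - c (e k) 2) / 2) : ℝ) : ℂ) - ((2 * Real.cos ((c (e k) 0 + c (e k) 2) / 2 - c (e k) 1) : ℝ) : ℂ))))
      {c | ∀ w ∈ S, c w 0 ≠ 0} := by
  have hc : ∀ (w : W) (l : Fin 3), ContDiff ℝ ∞ fun c : W → Fin 3 → ℝ => c w l := fun w l => contDiff_apply_apply (𝕜 := ℝ) (E := ℝ) w l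
  have hbr : ∀ w : W, ContDiff ℝ ∞ fun c : W → Fin 3 → ℝ => (I * (((2 * Real.cos ((c w 0 - c w 2) / 2) : ℝ) : ℂ) - ((2 * Real.cos ((c w 0 + c w 2) / 2 - c w 1) : ℝ) : ℂ))) := fun w =>
    contDiff_const.mul ((Complex.ofRealCLM.contDiff.comp (contDiff_const.mul (Real.contDiff_cos.comp (((hc w 0).sub (hc w 2)).div_const 2)))).sub
      (Complex.ofRealCLM.contDiff.comp (contDiff_const.mul (Real.contDiff_cos.comp ((((hc w 0).add (hc w 2)).div_const 2).sub (hc w 1))))))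
  intro c hq
  refine ContDiffAt.contDiffWithinAt ?_
  refine (contDiffAt_prod fun w _ => ?_).mul (contDiffAt_prod fun k _ => (hbr (e k)).contDiffAt)
  by_cases hS : w ∈ S
  · simp only [if_pos hS]
    exact contDiffAt_const.mul (contDiffAt_coe_splitFrozenFactor (hc w 0) (hc w 2) (hc w 1) (hq w hS))
  · simp only [if_neg hS]
    exact ((contDiff_coe_circleExp_comp_of_contDiff ((hc w 0).sub (hc w 2))).mul
      (((contDiff_const.sub (contDiff_coe_circleExp_comp_of_contDiff ((hc w 1).sub (hc w 0)))).mul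
        (contDiff_const.sub (contDiff_coe_circleExp_comp_of_contDiff ((hc w 2).sub (hc w 0))))).mul
        (contDiff_const.sub (contDiff_coe_circleExp_comp_of_contDiff ((hc w 2).sub (hc w 1)))))).contDiffAt

/-! ## §4 The corner bracket is non-zero at every m-wall-semiregular corner point -/

/-- **`Br(p) ≠ 0` AT AN m-WALL-SEMIREGULAR CORNER POINT `p`**: on all the walls `p_{(e k)0} = p_{(e k)2}`, third eigenvalue off at each corner place
(`e^{ip_{(e k)1}} ≠ e^{ip_{(e k)0}}`, so the corner bracket reads `i(2 − 2cos(θ_k − φ_k)) ≠ 0`), `G`-regular at the other compact-chart places and off the real walls at the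
split places (the frozen factors do not vanish, pattern of ★ `wallFactor_prod_erase_ne_zero_of_hcSemireg`). [cite: Shelstad1979, §4 p. 22; Lemma 4.3 (p. 25)] [cite: Rogawski1990, §8.2 p. 118] -/
theorem cornerBracket_ne_zero (S : Finset W) {m : ℕ} (e : Fin m ↪ W) {p : W → Fin 3 → ℝ}
    (hp02 : ∀ k, p (e k) 0 = p (e k) 2) (hp1 : ∀ k, Circle.exp (p (e k) 1) ≠ Circle.exp (p (e k) 0))
    (hreg : ∀ w, w ∉ S → w ∉ Set.range e → Function.Injective fun l : Fin 3 => Circle.exp (p w l))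
    (hsplit : ∀ w ∈ S, p w 0 ≠ 0) :
    (∏ w ∈ (Finset.univ.map e)ᶜ,
        ((if w ∈ S then (1 : ℂ) else (Circle.exp (p w 0 - p w 2) : ℂ)) *
          (if w ∈ S then
              ((|Real.exp (p w 0) - Real.exp (-p w 0)| *
                ‖Complex.exp (p w 0 + p w 2 * I) - Complex.exp (p w 1 * I)‖ * ‖Complex.exp (-p w 0 + p w 2 * I) - Complex.exp (p w 1 * I)‖ : ℝ) : ℂ)
            else (1 - (Circle.exp (p w 1 - p w 0) : ℂ)) * (1 - (Circle.exp (p w 2 - p w 0) : ℂ)) * (1 - (Circle.exp (p w 2 - p w 1) : ℂ))))) *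
      ∏ k, (I * (((2 * Real.cos ((p (e k) 0 - p (e k) 2) / 2) : ℝ) : ℂ) - ((2 * Real.cos ((p (e k) 0 + p (e k) 2) / 2 - p (e k) 1) : ℝ) : ℂ))) ≠ 0 := by
  refine mul_ne_zero (Finset.prod_ne_zero_iff.2 fun w hw => ?_) (Finset.prod_ne_zero_iff.2 fun k _ => ?_)
  · -- a non-corner place: the frozen factors
    have hrange : w ∉ Set.range e := fun ⟨k, hk⟩ => (Finset.mem_compl.1 hw) (Finset.mem_map.2 ⟨k, Finset.mem_univ _, hk⟩)
    refine mul_ne_zero ?_ ?_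
    · by_cases hS : w ∈ S
      · rw [if_pos hS]; exact one_ne_zero
      · rw [if_neg hS]; exact Circle.coe_ne_zero _
    · by_cases hS : w ∈ S
      · rw [if_pos hS, Complex.ofReal_ne_zero]
        have hx : p w 0 ≠ 0 := hsplit w hS
        refine mul_ne_zero (mul_ne_zero ((abs_exp_sub_exp_neg_ne_zero_iff _).2 hx) (norm_exp_add_mul_I_sub_exp_mul_I_ne_zero hx _ _)) ?_
        have hx' : -p w 0 ≠ 0 := neg_ne_zero.2 hx
        simpa only [Complex.ofReal_neg] using norm_exp_add_mul_I_sub_exp_mul_I_ne_zero hx' (p w 2) (p w 1)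
      · rw [if_neg hS]
        have hi := hreg w hS hrange
        refine mul_ne_zero (mul_ne_zero ((one_sub_coe_circleExp_sub_ne_zero_iff _ _).2 fun h => ?_)
          ((one_sub_coe_circleExp_sub_ne_zero_iff _ _).2 fun h => ?_)) ((one_sub_coe_circleExp_sub_ne_zero_iff _ _).2 fun h => ?_)
        · exact absurd (hi h) (by decide)
        · exact absurd (hi h) (by decide)
        · exact absurd (hi h) (by decide)
  · -- a corner place: `i(2 − 2cos(θ − φ)) ≠ 0`
    have hcos : Real.cos (p (e k) 0 - p (e k) 1) ≠ 1 := fun h => by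
      obtain ⟨n, hn⟩ := (Real.cos_eq_one_iff _).1 h
      apply hp1 k
      rw [show p (e k) 0 = p (e k) 1 + n * (2 * Real.pi) by linarith, Circle.exp_add, Circle.exp_int_mul_two_pi, mul_one]
    rw [show (p (e k) 0 - p (e k) 2) / 2 = 0 by rw [hp02 k]; ring, show (p (e k) 0 + p (e k) 2) / 2 - p (e k) 1 = p (e k) 0 - p (e k) 1 by rw [hp02 k]; ring,
      Real.cos_zero]
    refine mul_ne_zero I_ne_zero (sub_ne_zero.2 fun h => hcos ?_)
    have h' := Complex.ofReal_injective h
    linarith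

/-! ## §5 The package -/

/-- **THE m-FOLD DRESS PACKAGE** (F0P3a-p02 (g21)'s (D) consumer text): for an enumerated set of compact-chart corner places `e : Fin m ↪ W` (`e k ∉ S`) there is a corner
bracket `Br`, `C^∞` on the off-real-walls carrier `{c | ∀ w ∈ S, c w 0 ≠ 0}`, NON-ZERO at every m-wall-semiregular corner point, with
`e^{ρ}_S(c)·R′_S(c) = Br(c) · ∏_k 2 sin((c_{(e k)0} − c_{(e k)2})∕2)` for EVERY `c` (§2–§4). [cite: Shelstad1979, §4 Lemma 4.3 (p. 25)] [cite: Rogawski1990, §8.2 pp. 118–124]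
[cite: Bouaziz1994IntegralesOrbitales, §3.1 (I₁) p. 579] -/
theorem exists_cornerBracket (S : Finset W) {m : ℕ} (e : Fin m ↪ W) (he : ∀ k, e k ∉ S) :
    ∃ Br : (W → Fin 3 → ℝ) → ℂ, ContDiffOn ℝ ∞ Br {c | ∀ w ∈ S, c w 0 ≠ 0} ∧
      (∀ p : W → Fin 3 → ℝ, (∀ k, p (e k) 0 = p (e k) 2) → (∀ k, Circle.exp (p (e k) 1) ≠ Circle.exp (p (e k) 0)) →
        (∀ w, w ∉ S → w ∉ Set.range e → Function.Injective fun l : Fin 3 => Circle.exp (p w l)) → (∀ w ∈ S, p w 0 ≠ 0) → Br p ≠ 0) ∧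
      ∀ c : W → Fin 3 → ℝ, archERhoG S c * archRG S c = Br c * ∏ k, ((2 * Real.sin ((c (e k) 0 - c (e k) 2) / 2) : ℝ) : ℂ) :=
  ⟨_, contDiffOn_cornerBracket S e, fun _ h02 h1 hreg hsplit => cornerBracket_ne_zero S e h02 h1 hreg hsplit,
    archERhoG_mul_archRG_eq_cornerBracket_mul_prod_sin S e he⟩

end Literature.NumberTheory.Rogawski1990

end
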